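import Literature.MathematicalPhysics.QuantumFieldTheory.Balaban1983to89.Beta.RemainderDecay190SupNormPieces
import Literature.MathematicalPhysics.QuantumFieldTheory.Balaban1983to89.Beta.RemainderDecay190Periodised

/-!
# [Balaban1987RG1] (1.22) ∕ (5.10) with [Balaban1985Variational] (182) ∕ (190) on the (4.4)-space MODEL: the row-(D4)
# END with NODE D and NODE E BOTH fed by four periodised decaying pieces — no Sect. G letter, no kernel letter
# (`Beta.RemainderDecay190PeriodisedEnd`)

statement-level skeleton of published theorems with citation tags; proofs where landed; nothing here is a claim
about the Yang–Mills mass gap.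

HONEST FRAMING (cell rule).  Bookkeeping for the k-uniform remainder chain of row (D4) (`RemainderConst` ⇐ ONE
`ChainTFac190` instance, `Beta.RemainderDecay190`); discharges NOTHING of `BetaPertH`; NOT B12 Thm 2, NOT the continuum
limit, NOT Clay.  Unit `b2b-balaban-beta-an4` gen 96 (BINDER row D4 OWNER; cell pub-balaban).  Imports the two
generation-96 files `Beta.RemainderDecay190SupNormPieces` (the END per (k, p) with the NODE-E kernel letters from the
pieces, the (190)-socket still an input `∃ D, hrule`) and `Beta.RemainderDecay190Periodised` (the (190)-socket on the
cube torus from the same pieces) ONLY; nothing edited.  ONE COMPOSITION, no new idea.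

WHAT.  `remainderConst_of_stepObjects_periodisedPieces`: for the β-family `β` with one-loop split `S` on the boxes
`]0,γ]^{k+1}`, `RemainderConst S γ (ε₁ · K_rem,L(d, M, c, α₂, B₃(q)))` from, per scale `k` and history `p`: an exhausting
torus sequence; thin step objects with Lemma 3 (2.38) on their activities; a seam into the analyticity domains with
H-layer holomorphy; window sites ∕ functionals with the (1.7)-factorization; FOUR ℤ^d kernels `a₀ h₀ h 𝔡` decaying at a
common rate and block-periodic under every torus period, four torus operator families acting entrywise as their
periodisations, the (182)-composite `dH`; NUMERICS for the (190)-socket (`q.σ`, `q.cR`, `q.κB`, `q.δ15`, `q.Cst`, `q.m`,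
`q.θ` against the pieces' constants); and the (1.22) identification of `β¹_{k+1}(p)` against the WRITTEN read-out — under
N1–N3.  The (190)-socket hypothesis `hD` of `RemainderDecay190SupNormPieces.remainderConst_of_stepObjects_pieces182` is
DISCHARGED by `RemainderDecay190Periodised.exists_data190_of_pieces182_cubes_supNorm`.  AFTER THIS FILE the object-level
inputs of row (D4) on the model carrier are: NODE O ∕ A (step objects with (2.38)), NODE B (the seam), the window with
(1.7), the four pieces with (182), numerics, the (1.22) pin — and NO letter about δ𝐇∕δB.  HONEST ACCOUNTING: the pieces'
decay is where [15]'s (184)–(189) went (the decay of 𝔄₀ is an INPUT, not derived; (189) NOT discharged); nothing of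
Bałaban's is constructed; row D4 class UNCHANGED (instance 0∕1; critical-path width 0 = NODE O; D4 DISCHARGE NO DATE).
No `def`, no named fact, no `sorry`, standard axioms.
HONEST DEPENDENCY: continuum YM on T⁴ ⇐ BetaPertH ∧ nine spine estimates (0/9 proved); BetaPertH ⇐ (D1) ∧ (D4) ∧
CAP+tail; G-an2-4 gates asym, D1 and NE2/3/4.

Sources: [I] = T. Bałaban, Commun. Math. Phys. **109** (1987) 249–301 [Balaban1987RG1], (1.7) p. 261, (1.21)–(1.22)
p. 264, (4.4) p. 281, p. 282, (5.10) p. 293; [II] = Commun. Math. Phys. **116** (1988) 1–22 [Balaban1988RG2Cluster],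
p. 15, (2.38) p. 20; [15] = Commun. Math. Phys. **102** (1985) 277–309 [Balaban1985Variational], (182) p. 307, (190)
p. 308; [3] = Commun. Math. Phys. **96** (1984) 223–250 [Balaban1984PropagatorsII], (2.61) p. 234.
-/

namespace Literature.MathematicalPhysics.QuantumFieldTheory.Balaban1983to89.Beta.RemainderDecay190PeriodisedEnd

open Literature.MathematicalPhysics.QuantumFieldTheory.Balaban1983to89
open Literature.MathematicalPhysics.QuantumFieldTheory.Balaban1983to89.B13ScaleTransfer (Pt)
open Literature.MathematicalPhysics.QuantumFieldTheory.Balaban1983to89.TreeLengthTorus (TPt TDom proj)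
open Literature.MathematicalPhysics.QuantumFieldTheory.Balaban1983to89.B12Decay510 (mixedDeriv)
open Literature.MathematicalPhysics.QuantumFieldTheory.Balaban1983to89.B12Decay510Lattice (cubeOf)
open Literature.MathematicalPhysics.QuantumFieldTheory.Balaban1983to89.B12Decay510Window (K₁)
open Literature.MathematicalPhysics.QuantumFieldTheory.Balaban1983to89.B12Sec2to5 (l1)
open Literature.MathematicalPhysics.QuantumFieldTheory.Balaban1983to89.B11SectG (Eq182)
open Literature.MathematicalPhysics.QuantumFieldTheory.Balaban1983to89.Beta.RemainderLimitTorus (LDom tproj limKernel)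
open Literature.MathematicalPhysics.QuantumFieldTheory.Balaban1983to89.Beta.RemainderDecay190 (Consts190)
open Literature.MathematicalPhysics.QuantumFieldTheory.Balaban1983to89.Beta.RemainderChain (RemainderConst)
open Literature.MathematicalPhysics.QuantumFieldTheory.Balaban1983to89.Beta.RemainderChainLattice
  (CondsL SignsL remCoeffL)
open Literature.MathematicalPhysics.QuantumFieldTheory.Balaban1983to89.Beta.RemainderStepAdapterHolo (StepObjectD4)
open Literature.MathematicalPhysics.QuantumFieldTheory.Balaban1983to89.Beta
  (Kernel₂ IsPeriodic₂ Decay₂ compKer periodise₂)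
open Literature.MathematicalPhysics.QuantumFieldTheory.Balaban1983to89.Beta.RemainderLocalitySockets (restrictCLM)
open Literature.MathematicalPhysics.QuantumFieldTheory.Balaban1983to89.Beta.RemainderDecay190SupNormPieces
  (remainderConst_of_stepObjects_pieces182)
open Literature.MathematicalPhysics.QuantumFieldTheory.Balaban1983to89.Beta.RemainderDecay190Periodised
  (exists_data190_of_pieces182_cubes_supNorm)
open Metric Set Filter Topology

variable {d : ℕ} {M : ℕ} [NeZero M]

/-- **THE ROW-(D4) END ON THE MODEL CARRIER WITH NO LETTER ABOUT δ𝐇∕δB.**  `RemainderConst S γ (ε₁ · K_rem,L)` from, per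
(scale, history): the torus sequence, thin step objects + (2.38), seam + H-layer holomorphy, window sites ∕ functionals +
(1.7)-factorization, FOUR PERIODISED DECAYING PIECES assembled by (182), the socket NUMERICS, and the (1.22) pin against
the written read-out `a Y z := Re ∂²(F Y)(0)[(k₁₈₂(e Y i,0))_i, (k₁₈₂(e Y i,z))_i]`; under N1–N3.  The (190)-socket is
built by `RemainderDecay190Periodised.exists_data190_of_pieces182_cubes_supNorm` (block-torus weights `η L Mg R H` free),
the rest is `RemainderDecay190SupNormPieces.remainderConst_of_stepObjects_pieces182`.  Nothing of Bałaban's is asserted.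
[cite: Balaban1987RG1, (1.22) p.264, (1.7) p.261, (4.4) p.281, p.282 and (5.10) p.293; Balaban1988RG2Cluster, p.15 and (2.38) p.20; Balaban1985Variational, (182) p.307 and (190) p.308; Balaban1984PropagatorsII, (2.61) p.234] -/
theorem remainderConst_of_stepObjects_periodisedPieces {μ ν : Fin d} {β : FlowStep.HBeta} (S : B12Beta.OneLoopSplit β)
    {γ : ℝ} {c : B13.Consts} {ℓ α₂ : ℝ} {q : Consts190}
    (hC : CondsL d c ℓ) (h22 : c.R22gen ℓ) (hq : q.Valid c.δ₀) (hs : SignsL c α₂ q.B₃)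
    -- per (scale, history): the torus family, the step objects, (2.38), the seam, the H-layer datum
    (N : (k : ℕ) → (Fin (k + 1) → ℝ) → ℕ → ℕ) (hN : ∀ k p n, NeZero (N k p n))
    (hNlim : ∀ k p, Tendsto (N k p) atTop atTop)
    (O : (k : ℕ) → (p : Fin (k + 1) → ℝ) → (n : ℕ) → StepObjectD4 d (N k p n))
    (h3 : ∀ k p n, (O k p n).Lemma3OnH c ℓ)
    (emb : (k : ℕ) → (p : Fin (k + 1) → ℝ) → (n : ℕ) → TDom d (N k p n) →
      (TPt d (N k p n * M) → ℂ) → (O k p n).Φ)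
    (hemb : ∀ k p n X, ∀ v ∈ ball (0 : TPt d (N k p n * M) → ℂ) α₂, emb k p n X v ∈ (O k p n).sp2 X)
    (hH : ∀ k p n (X Z : TDom d (N k p n)), Z.1 ⊆ X.1 →
      DifferentiableOn ℂ (fun v => (O k p n).H Z (emb k p n X v)) (ball 0 α₂))
    -- per (scale, history, torus): the four Sect. G operators and their (182)-composite
    (dH A0 H0 Hk Dfr : (k : ℕ) → (p : Fin (k + 1) → ℝ) → (n : ℕ) →
      (TPt d (N k p n * M) → ℝ) →ₗ[ℝ] (TPt d (N k p n * M) → ℝ))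
    (h182 : ∀ k p n, Eq182 (dH k p n) (A0 k p n) (H0 k p n) (Hk k p n) (Dfr k p n))
    -- the window: sites, functionals, (1.7)-factorization
    {ι : LDom d → Type} [∀ Y, Fintype (ι Y)] (e : (Y : LDom d) → ι Y → Pt d)
    (he : ∀ Y i, cubeOf M (e Y i) ∈ Y.1) (hinj : ∀ Y, Function.Injective (e Y))
    (F : (k : ℕ) → (p : Fin (k + 1) → ℝ) → (Y : LDom d) → (ι Y → ℂ) → ℂ)
    (hfac : ∀ k p (Y : LDom d), ∀ᶠ n in atTop, ∀ v ∈ ball (0 : TPt d (N k p n * M) → ℂ) α₂,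
      (O k p n).E (tproj (N k p n) Y) (emb k p n (tproj (N k p n) Y) v) =
        F k p Y (restrictCLM (N k p n * M) (e Y) v))
    -- per (scale, history): the four ℤ^d pieces, decaying at a common rate, periodic under every torus period
    (a₀ h₀ h 𝔡 : (k : ℕ) → (Fin (k + 1) → ℝ) → Kernel₂ d) (Ca Ch₀ Ch Cd δ₀ : (k : ℕ) → (Fin (k + 1) → ℝ) → ℝ)
    (ha : ∀ k p, Decay₂ (a₀ k p) (Ca k p) (δ₀ k p)) (hh₀ : ∀ k p, Decay₂ (h₀ k p) (Ch₀ k p) (δ₀ k p))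
    (hh : ∀ k p, Decay₂ (h k p) (Ch k p) (δ₀ k p)) (hd : ∀ k p, Decay₂ (𝔡 k p) (Cd k p) (δ₀ k p))
    (hδ₀ : ∀ k p, 0 < δ₀ k p)
    (pa : ∀ k p n, IsPeriodic₂ (N k p n * M) (a₀ k p)) (ph₀ : ∀ k p n, IsPeriodic₂ (N k p n * M) (h₀ k p))
    (ph : ∀ k p n, IsPeriodic₂ (N k p n * M) (h k p)) (pd : ∀ k p n, IsPeriodic₂ (N k p n * M) (𝔡 k p))
    (hA0 : ∀ k p n (a b : TPt d (N k p n * M)), A0 k p n (Pi.single b 1) a = periodise₂ (N k p n * M) (a₀ k p) a b)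
    (hH0 : ∀ k p n (a b : TPt d (N k p n * M)), H0 k p n (Pi.single b 1) a = periodise₂ (N k p n * M) (h₀ k p) a b)
    (hHk : ∀ k p n (a b : TPt d (N k p n * M)), Hk k p n (Pi.single b 1) a = periodise₂ (N k p n * M) (h k p) a b)
    (hDfr : ∀ k p n (a b : TPt d (N k p n * M)), Dfr k p n (Pi.single b 1) a = periodise₂ (N k p n * M) (𝔡 k p) a b)
    -- numerics of the (190)-socket on the cube torus (block-torus weights free)
    (η L Mg R : (k : ℕ) → (Fin (k + 1) → ℝ) → ℕ → ℝ) (Hw : (k : ℕ) → (Fin (k + 1) → ℝ) → ℕ → Prop) {δr : ℝ}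
    (hδr : 0 < δr) (hσ₀ : 0 < q.σ) (hcR : B6.c0 δr (q.σ / δr) ^ d ≤ q.cR) (hκB : 1 ≤ q.κB)
    (hδ15 : ∀ k p, q.δ15 ≤ δ₀ k p / 2)
    (hCst : ∀ k p, ((Ca k p + Ch₀ k p) + |(-1 : ℝ)| *
        (Ch k p * (Cd k p * (Ca k p + Ch₀ k p) * ∑' w : Fin d → ℤ, Real.exp (-(δ₀ k p - δ₀ k p / 2) * l1 w)) *
          ∑' w : Fin d → ℤ, Real.exp (-(δ₀ k p / 2 - δ₀ k p / 4) * l1 w))) *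
        K₁ d (δ₀ k p / 8) * K₁ d (δ₀ k p / 16) ≤ q.Cst)
    (hm : 1 ≤ q.m) (hθ : 0 ≤ q.θ) (hθM : q.θ * M ≤ 1)
    -- the (1.22) identification against the WRITTEN read-out
    (beta1_eq : ∀ k p, p ∈ B12Beta.HistBox γ k →
      S.β1 k p = B12Beta.secondMoment (fun _ _ => limKernel fun Y z =>
        (mixedDeriv (F k p Y)
          (fun i => (((a₀ k p + h₀ k p) + fun x y =>
            (-1) * compKer (h k p) (compKer (𝔡 k p) (a₀ k p + h₀ k p)) x y) (e Y i) 0 : ℂ))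
          (fun i => (((a₀ k p + h₀ k p) + fun x y =>
            (-1) * compKer (h k p) (compKer (𝔡 k p) (a₀ k p + h₀ k p)) x y) (e Y i) z : ℂ))).re) μ ν) :
    RemainderConst S γ (c.ε₁ * remCoeffL d M c α₂ q.B₃) :=
  remainderConst_of_stepObjects_pieces182 S hC h22 hq hs N hN hNlim O h3 emb hemb hH dH A0 H0 Hk Dfr h182
    (fun k p => by
      haveI := hN k p
      exact exists_data190_of_pieces182_cubes_supNorm PUnit PUnit.unit (η k p) (L k p) (Mg k p) (R k p) (Hw k p)
        (dH k p) (A0 k p) (H0 k p) (Hk k p) (Dfr k p) (ha k p) (hh₀ k p) (hh k p) (hd k p) (hδ₀ k p) (pa k p)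
        (ph₀ k p) (ph k p) (pd k p) (h182 k p) (hA0 k p) (hH0 k p) (hHk k p) (hDfr k p) hδr hσ₀ hcR hκB (hδ15 k p)
        (hCst k p) hm hθ hθM)
    e he hinj F hfac a₀ h₀ h 𝔡 Ca Ch₀ Ch Cd δ₀ ha hh₀ hh hd hδ₀ pa ph₀ ph pd hA0 hH0 hHk hDfr beta1_eq

end Literature.MathematicalPhysics.QuantumFieldTheory.Balaban1983to89.Beta.RemainderDecay190PeriodisedEnd
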